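import Literature.Geometry.Riemannian.MeanCurvatureLocalReparametrization
import Literature.Geometry.Riemannian.GraphImmersion
import Literature.Geometry.Lorentzian.HypersurfaceRestriction
import Literature.Topology.FourManifolds.SmoothEmbeddingCriteria
import HarnessLib

/-!
# The local graph parametrisation of an embedded slice and its mean curvature

Topic `Literature/Geometry/Riemannian` (glue for the nonparametric description of a parametric
flow, White 2005 §2.5/§8.4).  Let `f : M → V` be a smooth embedding of a manifold modelled on `ℝᵏ`
into a Euclidean space, and let a piece of its image be a graph: `L ξ + u ξ ∈ range f` for all
`ξ` in an open set `B` of the parameter space `E'` (`dim E' = k`), `L` a linear isometry,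
`u ⊥ range L` smooth.  Then the local reparametrisation `φ = f⁻¹ ∘ (L + u)` is smooth on `B`
(`contMDiffOn_graphReparam`), `f ∘ φ = L + u` on `B` (`apply_graphReparam`), its differential is
bijective on `B` (`bijective_mfderiv_graphReparam`), and consequently the tree's mean curvature
of `f` at `φ ξ` with respect to any smooth field `ν` equals the mean curvature of the graph map
`L + u` at `ξ` with respect to `ν ∘ φ` (`meanCurvature_graphReparam_eq`): the mean curvature of a
slice may be computed in its graph parametrisation.

Everything is PROVED; no definitions, no named facts (the map `φ` is the explicit expression
`Function.invFun f ∘ (L + u)`).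

## References

* B. White, *A local regularity theorem for mean curvature flow*, Ann. of Math. 161 (2005),
  §2.5 and §8.4. [White2005]
* J. M. Lee, *Introduction to Smooth Manifolds*, 2nd ed., Springer 2013, Thm. 5.27, Cor. 5.30
  (maps into embedded submanifolds). [Lee2013]
-/

noncomputable section

open Bundle Set Function Module Filter
open scoped Manifold ContDiff Topology RealInnerProductSpace

namespace Literature.Geometry.Riemannian

open Lorentzian Lorentzian.PseudoRiemannianMetric EuclideanHypersurface
open Literature.Topology.FourManifolds (contMDiffOn_leftInverse_of_isImmersion)

variable {E' V : Type*} [NormedAddCommGroup E'] [InnerProductSpace ℝ E']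
  [NormedAddCommGroup V] [InnerProductSpace ℝ V]

/-- `f (f⁻¹ (L ξ + u ξ)) = L ξ + u ξ` at points where the graph lies in the image. [folklore] -/
theorem apply_graphReparam {M : Type*} [Nonempty M] {f : M → V} (L : E' →ₗᵢ[ℝ] V) (u : E' → V)
    {ξ : E'} (hξ : L ξ + u ξ ∈ range f) :
    f ((Function.invFun f ∘ fun ξ => L ξ + u ξ) ξ) = L ξ + u ξ :=
  Function.invFun_eq hξ

variable {k : ℕ} {M : Type*} [TopologicalSpace M] [ChartedSpace (EuclideanSpace ℝ (Fin k)) M]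
  [Nonempty M]

/-- **The local graph reparametrisation is smooth**: `φ = f⁻¹ ∘ (L + u)` is `C^∞` on the open set
`B` where the graph lies in the image of the smooth embedding `f`. [cite: Lee2013, Cor. 5.30] -/
theorem contMDiffOn_graphReparam {f : M → V} (he : Manifold.IsSmoothEmbedding (𝓡 k) 𝓘(ℝ, V) ∞ f)
    (L : E' →ₗᵢ[ℝ] V) {u : E' → V} (hu : ContDiff ℝ ∞ u) {B : Set E'}
    (hB : ∀ ξ ∈ B, L ξ + u ξ ∈ range f) :
    ContMDiffOn 𝓘(ℝ, E') (𝓡 k) ∞ (Function.invFun f ∘ fun ξ => L ξ + u ξ) B := by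
  have hle : LeftInverse (Function.invFun f) f := leftInverse_invFun he.isEmbedding.injective
  have hlc : ContMDiffOn 𝓘(ℝ, V) (𝓡 k) ∞ (Function.invFun f) (range f) :=
    contMDiffOn_leftInverse_of_isImmersion he.isImmersion he.isEmbedding hle
  have hg : ContMDiff 𝓘(ℝ, E') 𝓘(ℝ, V) ∞ fun ξ => L ξ + u ξ :=
    (L.toContinuousLinearMap.contDiff.add hu).contMDiff
  exact hlc.comp hg.contMDiffOn fun ξ hξ => hB ξ hξ

variable [FiniteDimensional ℝ E']

/-- **The differential of the local graph reparametrisation is bijective** (`dim E' = k`): it is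
injective because `d(f ∘ φ) = d(L + u)` is, and the dimensions agree. [folklore] -/
theorem bijective_mfderiv_graphReparam {f : M → V}
    (he : Manifold.IsSmoothEmbedding (𝓡 k) 𝓘(ℝ, V) ∞ f) (L : E' →ₗᵢ[ℝ] V) {u : E' → V}
    (hu : ContDiff ℝ ∞ u) (huK : ∀ x, u x ∈ (LinearMap.range L.toLinearMap)ᗮ) {B : Set E'}
    (hBo : IsOpen B) (hB : ∀ ξ ∈ B, L ξ + u ξ ∈ range f) (hdim : finrank ℝ E' = k) {ξ : E'}
    (hξ : ξ ∈ B) :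
    Bijective (mfderiv 𝓘(ℝ, E') (𝓡 k) (Function.invFun f ∘ fun ξ => L ξ + u ξ) ξ) := by
  set φ := Function.invFun f ∘ fun ξ => L ξ + u ξ with hφ
  have hφs : ContMDiffAt 𝓘(ℝ, E') (𝓡 k) ∞ φ ξ :=
    (contMDiffOn_graphReparam he L hu hB).contMDiffAt (hBo.mem_nhds hξ)
  have hφd : MDifferentiableAt 𝓘(ℝ, E') (𝓡 k) φ ξ := hφs.mdifferentiableAt (by simp)
  have hfd : MDifferentiableAt (𝓡 k) 𝓘(ℝ, V) f (φ ξ) :=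
    (he.contMDiff (φ ξ)).mdifferentiableAt (by simp)
  -- `f ∘ φ = L + u` near `ξ`
  have heq : f ∘ φ =ᶠ[𝓝 ξ] fun ξ => L ξ + u ξ := by
    filter_upwards [hBo.mem_nhds hξ] with ζ hζ
    exact apply_graphReparam L u (hB ζ hζ)
  have hgraph := isSpacelikeImmersion_graph L hu huK
  have hinj_g : Injective (mfderiv 𝓘(ℝ, E') 𝓘(ℝ, V) (fun ξ => L ξ + u ξ) ξ) :=
    hgraph.injective_mfderiv ξ
  have hcomp : mfderiv 𝓘(ℝ, E') 𝓘(ℝ, V) (fun ξ => L ξ + u ξ) ξ =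
      (mfderiv (𝓡 k) 𝓘(ℝ, V) f (φ ξ)).comp (mfderiv 𝓘(ℝ, E') (𝓡 k) φ ξ) := by
    rw [← heq.mfderiv_eq, mfderiv_comp ξ hfd hφd]
  have hinj : Injective (mfderiv 𝓘(ℝ, E') (𝓡 k) φ ξ) := by
    rw [hcomp] at hinj_g
    exact Injective.of_comp hinj_g
  -- dimension count
  refine ⟨hinj, ?_⟩
  haveI : FiniteDimensional ℝ (TangentSpace 𝓘(ℝ, E') ξ) :=
    inferInstanceAs (FiniteDimensional ℝ E')
  haveI : FiniteDimensional ℝ (TangentSpace (𝓡 k) (φ ξ)) :=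
    inferInstanceAs (FiniteDimensional ℝ (EuclideanSpace ℝ (Fin k)))
  have hdim' : finrank ℝ (TangentSpace 𝓘(ℝ, E') ξ) = finrank ℝ (TangentSpace (𝓡 k) (φ ξ)) := by
    change finrank ℝ E' = finrank ℝ (EuclideanSpace ℝ (Fin k))
    rw [hdim, finrank_euclideanSpace_fin]
  exact (LinearMap.injective_iff_surjective_of_finrank_eq_finrank
    (f := (mfderiv 𝓘(ℝ, E') (𝓡 k) φ ξ).toLinearMap) hdim').1 hinj

variable [IsManifold (𝓡 k) ∞ M] [FiniteDimensional ℝ V] [(euclideanMetric V).HasLeviCivita]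

/-- Congruence of the mean curvature in the immersion (local copy of the tree's
`meanCurvature_congr_fun` of `BoundaryCylinderSliceData.lean`, to keep imports light). [folklore] -/
private theorem meanCurvature_congr_fun' {EN : Type*} [NormedAddCommGroup EN] [NormedSpace ℝ EN]
    {HN : Type*} [TopologicalSpace HN] {IN : ModelWithCorners ℝ EN HN} {N : Type*}
    [TopologicalSpace N] [ChartedSpace HN N] [IsManifold IN ∞ N] [FiniteDimensional ℝ EN]
    {f₁ f₂ : N → V} (h : f₁ = f₂) (hpb : contMDiff_pullbackBilin 𝓘(ℝ, V) V IN N ∞)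
    (hf₁ : (euclideanMetric V).IsSpacelikeImmersion IN f₁)
    (hf₂ : (euclideanMetric V).IsSpacelikeImmersion IN f₂) (ν : N → V) (y : N) :
    (euclideanMetric V).meanCurvature f₁ hpb hf₁ ν y =
      (euclideanMetric V).meanCurvature f₂ hpb hf₂ ν y := by
  subst h; rfl

/-- **The mean curvature of an embedded slice in its graph parametrisation**: for `ξ ∈ B` and a
smooth field `ν` along `f`,
`H_{f, ν}(φ ξ) = H_{L + u, ν ∘ φ}(ξ)`, `φ = f⁻¹ ∘ (L + u)`. [cite: White2005, §8.4] -/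
theorem meanCurvature_graphReparam_eq {f : M → V}
    (he : Manifold.IsSmoothEmbedding (𝓡 k) 𝓘(ℝ, V) ∞ f)
    (hf : (euclideanMetric V).IsSpacelikeImmersion (𝓡 k) f)
    {ν : M → V} (hν : ContMDiff (𝓡 k) 𝓘(ℝ, V) ∞ ν)
    (L : E' →ₗᵢ[ℝ] V) {u : E' → V} (hu : ContDiff ℝ ∞ u)
    (huK : ∀ x, u x ∈ (LinearMap.range L.toLinearMap)ᗮ) {B : TopologicalSpace.Opens E'}
    (hB : ∀ ξ ∈ (B : Set E'), L ξ + u ξ ∈ range f) (hdim : finrank ℝ E' = k) {ξ : E'}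
    (hξ : ξ ∈ (B : Set E')) :
    (euclideanMetric V).meanCurvature f contMDiff_pullbackBilin_holds hf ν
        ((Function.invFun f ∘ fun ξ => L ξ + u ξ) ξ) =
      (euclideanMetric V).meanCurvature (fun x => L x + u x) contMDiff_pullbackBilin_holds
        (isSpacelikeImmersion_graph L hu huK)
        (fun x => ν ((Function.invFun f ∘ fun ξ => L ξ + u ξ) x)) ξ := by
  set φ := Function.invFun f ∘ fun ξ => L ξ + u ξ with hφ
  set hgr := isSpacelikeImmersion_graph L hu huK
  -- the restriction `Ψ = φ ∘ ι : B → M`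
  set Ψ : B → M := φ ∘ Subtype.val with hΨ
  have hφon : ContMDiffOn 𝓘(ℝ, E') (𝓡 k) ∞ φ B := contMDiffOn_graphReparam he L hu hB
  have hΨs : ContMDiff 𝓘(ℝ, E') (𝓡 k) ∞ Ψ :=
    hφon.comp_contMDiff contMDiff_subtype_val fun y => y.2
  -- `f ∘ Ψ = (L + u) ∘ ι`
  have hfΨ : f ∘ Ψ = (fun x => L x + u x) ∘ (Subtype.val : B → E') := by
    funext y
    exact apply_graphReparam L u (hB y.1 y.2)
  have hgrW : (euclideanMetric V).IsSpacelikeImmersion 𝓘(ℝ, E')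
      ((fun x => L x + u x) ∘ (Subtype.val : B → E')) := hgr.comp_subtypeVal
  have hfΨimm : (euclideanMetric V).IsSpacelikeImmersion 𝓘(ℝ, E') (f ∘ Ψ) := hfΨ ▸ hgrW
  -- bijectivity of `dΨ` at `⟨ξ, hξ⟩`
  set y : B := ⟨ξ, hξ⟩ with hy
  have hφd : MDifferentiableAt 𝓘(ℝ, E') (𝓡 k) φ ξ :=
    ((hφon.contMDiffAt (B.isOpen.mem_nhds hξ)).mdifferentiableAt (by simp))
  have hΨd : MDifferentiableAt 𝓘(ℝ, E') (𝓡 k) Ψ y := (hΨs y).mdifferentiableAt (by simp)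
  have hdΨ : mfderiv 𝓘(ℝ, E') (𝓡 k) Ψ y = mfderiv 𝓘(ℝ, E') (𝓡 k) φ ξ := by
    rw [hΨ, mfderiv_comp y hφd (hasMFDerivAt_subtypeVal y).mdifferentiableAt,
      mfderiv_subtypeVal]
    exact ContinuousLinearMap.comp_id _
  have hbij : Bijective (mfderiv 𝓘(ℝ, E') (𝓡 k) Ψ y) := by
    rw [hdΨ]
    exact bijective_mfderiv_graphReparam he L hu huK B.isOpen hB hdim hξ
  -- differentiability of the lift of `ν` at `Ψ y`
  have hνl : MDifferentiableAt (𝓡 k) 𝓘(ℝ, V).tangent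
      (fun x ↦ (TotalSpace.mk' V (f x) (ν x) : TangentBundle 𝓘(ℝ, V) V)) (Ψ y) :=
    mdifferentiableAt_lift ((hf.contMDiff (Ψ y)).mdifferentiableAt (by simp))
      ((hν (Ψ y)).mdifferentiableAt (by simp))
  -- assemble
  have h1 := meanCurvature_comp_right_of_bijective (euclideanMetric V)
    contMDiff_pullbackBilin_holds contMDiff_pullbackBilin_holds hf hfΨimm
    BoundarylessManifold.isInteriorPoint BoundarylessManifold.isInteriorPoint hνl hΨd hbij
  -- `h1 : H_{f ∘ Ψ, ν ∘ Ψ}(y) = H_{f, ν}(Ψ y)`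
  have h2 := meanCurvature_congr_fun' hfΨ contMDiff_pullbackBilin_holds hfΨimm hgrW
    (fun y' => ν (Ψ y')) y
  have h3 := meanCurvature_comp_subtypeVal (g := euclideanMetric V) (W := B)
    contMDiff_pullbackBilin_holds contMDiff_pullbackBilin_holds hgr (fun x => ν (φ x)) y
  -- `h3 : H_{(L+u) ∘ ι, (ν ∘ φ) ∘ ι}(y) = H_{L+u, ν ∘ φ}(ξ)`
  change (euclideanMetric V).meanCurvature f contMDiff_pullbackBilin_holds hf ν (Ψ y) = _
  rw [← h1, h2]
  exact h3

end Literature.Geometry.Riemannian
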